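import Mathlib
import Summits.CriticalPhenomena.PercolationContinuityZ3.Theorems.PercNearOneGluingNoHeavyLowerTailSahiCombFiveUpSetRank
import Summits.CriticalPhenomena.PercolationContinuityZ3.Theorems.PercNearOneGluingNoHeavyLowerTailSahiCombTriWTiltCert
import Summits.CriticalPhenomena.PercolationContinuityZ3.Theorems.PercNearOneGluingNoHeavyLowerTailSahiCombTriWCertGenBoundary
import Summits.CriticalPhenomena.PercolationContinuityZ3.Theorems.PercNearOneGluingNoHeavyLowerTailSahiCombFiveUpSetProduct

/-!
# The PLAIN two-copy certificate is injective for a SELF-DUAL cylinder — kernel form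

Support file of the one-cut programme (crux `NoHeavyLowerTail`, stmt-CriticalPhenomena-4575; lemma factory `prim-lf-1`, gen 33; memo
`FROM-prim-lf-1-gen33-TROPICAL-AND-GENERIC-BLOCKS.md` §8).  Setting of the cylinder dipole (`…SahiCombTriWDipoleCert`): levels `v, w : Finset β`,
points `d, u : Finset γ`, an up-set `P` of points and a monotone family `F` of up-sets; demand tokens `D₁(v) = refl P ∩ F v`, `D₂(v) = P ∩ refl (F vᶜ)`,
`D₃(v) = refl P ∩ refl (F vᶜ)`, supply tokens `A(w) = B(w) = P ∩ F w`, `E(w) = refl P ∩ F wᶜ`; the PLAIN certificate is the 0/1 matrix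
`D₁:[ζ|ζ|0], D₂:[0|ζ|0], D₃:[ζ|0|ζ]` with `ζ((v,d),(w,u)) = [v ⊆ w ∧ d ⊆ u]` (`= tiltCert 1`).

`P` is SELF-DUAL when `refl P = Pᶜ`, i.e. `uᶜ ∈ P ↔ u ∉ P` (dictators, majorities of odd size, … — the maximal intersecting up-sets).

* `eq_zero_of_zeta_sum_eq_zero_prod` — C1 (the antipodal basis) on the PRODUCT cube `Finset β × Finset γ`, transported from `Finset (β ⊕ γ)` along
  `Finset.sumEquiv`.
* **`plainKernel_selfDual`** — for self-dual `P`: if `a, b, c` are supported on the `D₁, D₂, D₃` tokens and satisfy the three column equations of the plain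
  certificate (`(A)`: `ζ(a+c) = 0` on `A`, `(B)`: `ζ(a+b) = 0` on `B`, `(E)`: `ζc = 0` on `E`), then `a = b = c = 0`.
  Proof (memo §8): `(A)−(B)` gives `ζc = ζb` on `W = {(w,u) : u ∈ P ∩ F w}`; with the base support lemma (`exists_support_coef` for `P`) one writes down a
  LEVEL-PRESERVING candidate `c'(v,e) = Σ_d b(v,d)·coef_d(e)` with `ζc' = ζb` on `W` and `supp c' ⊆ D₃ = refl W`, so `c = c'` by C1 on the product cube;
  `(E)` and a Möbius induction over the levels give `Σ_e c(v,e)[e ⊆ u] = 0` for every level `v` and every `u ∈ refl P ∩ F vᶜ`; then for each level `v`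
  the function `b(v,·) − c(v,·)` is supported on `refl (F vᶜ)` and its zeta transform vanishes on `F vᶜ = (P ∩ F vᶜ) ∪ (refl P ∩ F vᶜ)` (self-duality),
  so it vanishes (C1 for `F vᶜ`); the supports of `b(v,·) ⊆ P` and `c(v,·) ⊆ refl P` are disjoint (self-duality), so `b = c = 0`; finally `a = 0` by
  C2′ level by level (cumulating `a` over the levels below `w`).
The rank / inequality consequences (`tiltCert 1` has independent rows; `0 ≤ triW P F G` for self-dual `P`, every `a`) are in `…SahiCombTriWSelfDual`.
Census behind the statement (lf-1 gen 33): the plain certificate is of full row rank on all 145,246 self-dual cylinder configurations with `#β + #γ ≤ 5`.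
HONEST LABEL: fully proved (std axioms); no conjecture is used. [this work]
-/

namespace Summit.CriticalPhenomena.PercolationContinuityZ3.Theorems

namespace FiveUpSet

open Finset

variable {β γ : Type} [DecidableEq β] [Fintype β] [DecidableEq γ] [Fintype γ]

/-! ### C1 on the product cube -/

/-- **C1 on the product cube** `Finset β × Finset γ` (componentwise order, antipode `(v,d) ↦ (vᶜ,dᶜ)`): if `W` is an up-set of pairs, `g` is
supported on the antipodes of `W` and `Σ_p g p [p ≤ q] = 0` for every `q ∈ W`, then `g = 0`.  Transport of `eq_zero_of_zeta_sum_eq_zero` along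
`Finset.sumEquiv : Finset (β ⊕ γ) ≃o Finset β × Finset γ`. [this work] -/
theorem eq_zero_of_zeta_sum_eq_zero_prod (W : Finset (Finset β × Finset γ))
    (hW : ∀ p q : Finset β × Finset γ, p.1 ⊆ q.1 → p.2 ⊆ q.2 → p ∈ W → q ∈ W)
    (g : Finset β × Finset γ → ℚ) (hg : ∀ p, g p ≠ 0 → (p.1ᶜ, p.2ᶜ) ∈ W)
    (h : ∀ q ∈ W, ∑ p, g p * (if p.1 ⊆ q.1 ∧ p.2 ⊆ q.2 then (1 : ℚ) else 0) = 0) :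
    ∀ p, g p = 0 := by
  classical
  set e : Finset (β ⊕ γ) ≃o Finset β × Finset γ := Finset.sumEquiv with he
  let W' : Finset (Finset (β ⊕ γ)) := W.image (fun q => e.symm q)
  have hmemW' : ∀ s, s ∈ W' ↔ e s ∈ W := by
    intro s
    constructor
    · intro hs
      obtain ⟨q, hq, hqs⟩ := mem_image.1 hs
      rw [← hqs, OrderIso.apply_symm_apply]
      exact hq
    · intro hs
      exact mem_image.2 ⟨e s, hs, OrderIso.symm_apply_apply e s⟩
  have hW' : IsUpperSet (W' : Set (Finset (β ⊕ γ))) := by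
    intro s t hst hs
    rw [mem_coe, hmemW'] at hs ⊢
    have hle : e s ≤ e t := e.monotone hst
    exact hW _ _ hle.1 hle.2 hs
  have hcompl : ∀ s : Finset (β ⊕ γ), e sᶜ = ((e s).1ᶜ, (e s).2ᶜ) := by
    intro s
    rw [he, LatticeFiveUpSet.sumEquiv_compl, LatticeFiveUpSet.prodCompl_apply]
  have hg' : ∀ s, g (e s) ≠ 0 → sᶜ ∈ W' := by
    intro s hs
    rw [hmemW', hcompl]
    exact hg (e s) hs
  have h' : ∀ t ∈ W', ∑ s, g (e s) * (if s ⊆ t then (1 : ℚ) else 0) = 0 := by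
    intro t ht
    rw [hmemW'] at ht
    have key : ∑ s, g (e s) * (if s ⊆ t then (1 : ℚ) else 0)
        = ∑ p, g p * (if p.1 ⊆ (e t).1 ∧ p.2 ⊆ (e t).2 then (1 : ℚ) else 0) := by
      refine Fintype.sum_equiv e.toEquiv _ _ (fun s => ?_)
      have hiff : s ⊆ t ↔ ((e s).1 ⊆ (e t).1 ∧ (e s).2 ⊆ (e t).2) := by
        rw [← Prod.le_def]; exact (e.le_iff_le).symm
      have hes : e.toEquiv s = e s := rfl
      rw [hes]
      by_cases hst : s ⊆ t
      · rw [if_pos hst, if_pos (hiff.1 hst)]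
      · rw [if_neg hst, if_neg (fun hh => hst (hiff.2 hh))]
    rw [key]
    exact h (e t) ht
  have hz := eq_zero_of_zeta_sum_eq_zero hW' (fun s => g (e s)) hg' h'
  intro p
  have := hz (e.symm p)
  simpa using this

/-! ### Zeta sums on the product cube -/

/-- `[A ∧ B] = [A]·[B]` for indicator values in `ℚ`. [folklore] -/
theorem ite_and_eq_mul (A B : Prop) [Decidable A] [Decidable B] :
    (if A ∧ B then (1 : ℚ) else 0) = (if A then (1 : ℚ) else 0) * (if B then (1 : ℚ) else 0) := by
  split_ifs <;> simp_all

/-- Splitting the product zeta transform by levels: `Σ_p f p [p ≤ (w,u)] = Σ_v [v ⊆ w]·Σ_d f (v,d) [d ⊆ u]`. [this work] -/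
theorem zsum_eq_sum_lsum (f : Finset β × Finset γ → ℚ) (w : Finset β) (u : Finset γ) :
    (∑ p, f p * (if p.1 ⊆ w ∧ p.2 ⊆ u then (1 : ℚ) else 0))
      = ∑ v, (if v ⊆ w then (1 : ℚ) else 0) * (∑ d, f (v, d) * (if d ⊆ u then (1 : ℚ) else 0)) := by
  rw [Fintype.sum_prod_type]
  refine Finset.sum_congr rfl fun v _ => ?_
  rw [Finset.mul_sum]
  refine Finset.sum_congr rfl fun d _ => ?_
  rw [ite_and_eq_mul]; ring

/-- Möbius step on the levels: if the level sums below `w` vanish, the product zeta sum at `w` is the level-`w` sum. [this work] -/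
theorem zsum_eq_lsum_of_lt (f : Finset β × Finset γ → ℚ) (w : Finset β) (u : Finset γ)
    (h : ∀ v, v ⊂ w → (∑ d, f (v, d) * (if d ⊆ u then (1 : ℚ) else 0)) = 0) :
    (∑ p, f p * (if p.1 ⊆ w ∧ p.2 ⊆ u then (1 : ℚ) else 0)) = (∑ d, f (w, d) * (if d ⊆ u then (1 : ℚ) else 0)) := by
  rw [zsum_eq_sum_lsum, ← Finset.add_sum_erase _ _ (mem_univ w), if_pos (Finset.Subset.refl w), one_mul, add_eq_left]
  refine Finset.sum_eq_zero fun v hv => ?_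
  have hvw : v ≠ w := (mem_erase.1 hv).1
  by_cases hsub : v ⊆ w
  · rw [h v (Finset.ssubset_iff_subset_ne.2 ⟨hsub, hvw⟩), mul_zero]
  · rw [if_neg hsub, zero_mul]

/-! ### The kernel theorem -/

/-- **The plain certificate is injective for a self-dual cylinder (kernel form).**  `P` an up-set with `uᶜ ∈ P ↔ u ∉ P`, `F` a monotone family
of up-sets; `a, b, c` supported on the demand tokens `D₁, D₂, D₃`; if the three column equations of the plain two-copy certificate hold, then
`a = b = c = 0`. [this work] -/
theorem plainKernel_selfDual (P : Finset (Finset γ)) (F : Finset β → Finset (Finset γ))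
    (hP : IsUpperSet (P : Set (Finset γ))) (hF : ∀ x, IsUpperSet (F x : Set (Finset γ))) (hFm : Monotone F)
    (hsd : ∀ u : Finset γ, uᶜ ∈ P ↔ u ∉ P)
    (a b c : Finset β × Finset γ → ℚ)
    (ha : ∀ p, a p ≠ 0 → p.2 ∈ refl P ∩ F p.1)
    (hb : ∀ p, b p ≠ 0 → p.2 ∈ P ∩ refl (F p.1ᶜ))
    (hc : ∀ p, c p ≠ 0 → p.2 ∈ refl P ∩ refl (F p.1ᶜ))
    (hA : ∀ w u, u ∈ P ∩ F w → (∑ p, a p * (if p.1 ⊆ w ∧ p.2 ⊆ u then (1 : ℚ) else 0)) + (∑ p, c p * (if p.1 ⊆ w ∧ p.2 ⊆ u then (1 : ℚ) else 0)) = 0)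
    (hB : ∀ w u, u ∈ P ∩ F w → (∑ p, a p * (if p.1 ⊆ w ∧ p.2 ⊆ u then (1 : ℚ) else 0)) + (∑ p, b p * (if p.1 ⊆ w ∧ p.2 ⊆ u then (1 : ℚ) else 0)) = 0)
    (hE : ∀ w u, u ∈ refl P ∩ F wᶜ → (∑ p, c p * (if p.1 ⊆ w ∧ p.2 ⊆ u then (1 : ℚ) else 0)) = 0) :
    (∀ p, a p = 0) ∧ (∀ p, b p = 0) ∧ (∀ p, c p = 0) := by
  classical
  -- (1) ζc = ζb on W
  have hCB : ∀ w u, u ∈ P ∩ F w → (∑ p, c p * (if p.1 ⊆ w ∧ p.2 ⊆ u then (1 : ℚ) else 0)) = (∑ p, b p * (if p.1 ⊆ w ∧ p.2 ⊆ u then (1 : ℚ) else 0)) := by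
    intro w u hu
    have h1 := hA w u hu; have h2 := hB w u hu
    linarith
  -- (2) base support coefficients for `P`
  have hcoefE := fun d => exists_support_coef hP d
  choose coef _hcoef0 hcoefsupp hcoefid using hcoefE
  -- the level-preserving candidate
  let c' : Finset β × Finset γ → ℚ := fun p => ∑ d, b (p.1, d) * coef d p.2
  -- (3) support of c'
  have hc' : ∀ p, c' p ≠ 0 → p.2 ∈ refl P ∩ refl (F p.1ᶜ) := by
    intro p hp
    obtain ⟨d, -, hd⟩ := Finset.exists_ne_zero_of_sum_ne_zero hp
    have hbd : b (p.1, d) ≠ 0 := fun h0 => hd (by rw [h0, zero_mul])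
    have hce : coef d p.2 ≠ 0 := fun h0 => hd (by rw [h0, mul_zero])
    obtain ⟨hePc, hed⟩ := hcoefsupp d p.2 hce
    have hdmem := hb (p.1, d) hbd
    rw [mem_inter, mem_refl] at hdmem
    rw [mem_inter, mem_refl, mem_refl]
    refine ⟨hePc, ?_⟩
    exact hF _ (Finset.compl_subset_compl.2 hed) hdmem.2
  -- (4) ζc' = ζb at every (w,u) with u ∈ P
  have hlsum_c' : ∀ v u, u ∈ P → (∑ d, c' (v, d) * (if d ⊆ u then (1 : ℚ) else 0)) = (∑ d, b (v, d) * (if d ⊆ u then (1 : ℚ) else 0)) := by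
    intro v u hu
    simp only [c']
    -- Σ_e (Σ_d b(v,d) coef d e) [e ⊆ u] = Σ_d b(v,d) Σ_e coef d e [e ⊆ u] = Σ_d b(v,d) [d ⊆ u]
    have hswap : ∑ e, (∑ d, b (v, d) * coef d e) * (if e ⊆ u then (1 : ℚ) else 0)
        = ∑ d, b (v, d) * ∑ e, coef d e * (if e ⊆ u then (1 : ℚ) else 0) := by
      simp only [Finset.sum_mul, Finset.mul_sum, mul_assoc]
      rw [Finset.sum_comm]
    rw [hswap]
    refine Finset.sum_congr rfl fun d _ => ?_
    rw [← hcoefid d u hu]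
  have hzsum_c' : ∀ w u, u ∈ P → (∑ p, c' p * (if p.1 ⊆ w ∧ p.2 ⊆ u then (1 : ℚ) else 0)) = (∑ p, b p * (if p.1 ⊆ w ∧ p.2 ⊆ u then (1 : ℚ) else 0)) := by
    intro w u hu
    rw [zsum_eq_sum_lsum, zsum_eq_sum_lsum]
    refine Finset.sum_congr rfl fun v _ => ?_
    rw [hlsum_c' v u hu]
  -- (5) c = c' by C1 on the product cube
  have hcc' : ∀ p, c p = c' p := by
    let Wset : Finset (Finset β × Finset γ) := univ.filter (fun q => q.2 ∈ P ∩ F q.1)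
    have hWmem : ∀ q, q ∈ Wset ↔ q.2 ∈ P ∩ F q.1 := fun q => by simp [Wset]
    have hz := eq_zero_of_zeta_sum_eq_zero_prod Wset ?_ (fun p => c p - c' p) ?_ ?_
    · intro p; have := hz p; linarith
    · intro p q h1 h2 hp
      rw [hWmem, mem_inter] at hp ⊢
      exact ⟨hP h2 hp.1, hFm h1 (hF _ h2 hp.2)⟩
    · intro p hp
      have hmem : p.2 ∈ refl P ∩ refl (F p.1ᶜ) := by
        by_cases hcp : c p = 0
        · have : c' p ≠ 0 := by intro h0; apply hp; rw [hcp, h0, sub_zero]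
          exact hc' p this
        · exact hc p hcp
      rw [mem_inter, mem_refl, mem_refl] at hmem
      rw [hWmem, mem_inter]
      exact hmem
    · intro q hq
      rw [hWmem] at hq
      have hsplit : ∑ p, (c p - c' p) * (if p.1 ⊆ q.1 ∧ p.2 ⊆ q.2 then (1 : ℚ) else 0)
          = (∑ p, c p * (if p.1 ⊆ q.1 ∧ p.2 ⊆ q.2 then (1 : ℚ) else 0)) - (∑ p, c' p * (if p.1 ⊆ q.1 ∧ p.2 ⊆ q.2 then (1 : ℚ) else 0)) := by
        rw [← Finset.sum_sub_distrib]
        refine Finset.sum_congr rfl fun p _ => ?_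
        ring
      rw [hsplit, hzsum_c' q.1 q.2 (mem_inter.1 hq).1, hCB q.1 q.2 hq, sub_self]
  -- (6) (E) level by level: the level sums of c vanish for u ∈ refl P ∩ F vᶜ
  have hElev : ∀ v u, u ∈ refl P → u ∈ F vᶜ → (∑ d, c (v, d) * (if d ⊆ u then (1 : ℚ) else 0)) = 0 := by
    intro v
    induction v using Finset.strongInduction with
    | H v ih =>
      intro u huP huF
      have hlt : ∀ v', v' ⊂ v → (∑ d, c (v', d) * (if d ⊆ u then (1 : ℚ) else 0)) = 0 := by
        intro v' hv'
        refine ih v' hv' u huP ?_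
        exact hFm (Finset.compl_subset_compl.2 hv'.subset) huF
      rw [← zsum_eq_lsum_of_lt c v u hlt]
      exact hE v u (mem_inter.2 ⟨huP, huF⟩)
  -- (7) per level: b(v,·) = c(v,·), then both vanish
  have hbc : ∀ v d, b (v, d) = 0 ∧ c (v, d) = 0 := by
    intro v
    have hψ := eq_zero_of_zeta_sum_eq_zero (hF vᶜ) (fun d => b (v, d) - c (v, d)) ?_ ?_
    · intro d
      have hbd : b (v, d) = c (v, d) := by have := hψ d; linarith
      by_cases h0 : b (v, d) = 0
      · exact ⟨h0, by rw [← hbd, h0]⟩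
      · exfalso
        have h1 := hb (v, d) h0
        have h2 := hc (v, d) (by rw [← hbd]; exact h0)
        rw [mem_inter] at h1 h2
        exact ((hsd d).1 (mem_refl.1 h2.1)) h1.1
    · intro d hd
      by_cases h0 : b (v, d) = 0
      · have hcd : c (v, d) ≠ 0 := by intro h1; apply hd; simp [h0, h1]
        exact mem_refl.1 (mem_inter.1 (hc (v, d) hcd)).2
      · exact mem_refl.1 (mem_inter.1 (hb (v, d) h0)).2
    · intro t ht
      have hsplit : ∑ d, (b (v, d) - c (v, d)) * (if d ⊆ t then (1 : ℚ) else 0)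
          = (∑ d, b (v, d) * (if d ⊆ t then (1 : ℚ) else 0)) - (∑ d, c (v, d) * (if d ⊆ t then (1 : ℚ) else 0)) := by
        rw [← Finset.sum_sub_distrib]
        refine Finset.sum_congr rfl fun d _ => ?_
        ring
      rw [hsplit]
      by_cases htP : t ∈ P
      · -- on P: ζc = ζc' = ζb
        have hcl : (∑ d, c (v, d) * (if d ⊆ t then (1 : ℚ) else 0)) = (∑ d, c' (v, d) * (if d ⊆ t then (1 : ℚ) else 0)) := by
          refine Finset.sum_congr rfl fun d _ => ?_
          rw [hcc' (v, d)]
        rw [hcl, hlsum_c' v t htP, sub_self]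
      · -- off P: t ∈ refl P (self-duality); ζc = 0 by (E), ζb = 0 since b lives on P
        have htR : t ∈ refl P := mem_refl.2 ((hsd t).2 htP)
        rw [hElev v t htR (mem_coe.1 ht)]
        have hb0 : (∑ d, b (v, d) * (if d ⊆ t then (1 : ℚ) else 0)) = 0 := by
          refine Finset.sum_eq_zero fun d _ => ?_
          by_cases h0 : b (v, d) = 0
          · rw [h0, zero_mul]
          · have hdP : d ∈ P := (mem_inter.1 (hb (v, d) h0)).1
            have hdt : ¬ d ⊆ t := fun hsub => htP (hP hsub hdP)
            rw [if_neg hdt, mul_zero]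
        rw [hb0, sub_self]
  have hb0 : ∀ p, b p = 0 := fun p => (hbc p.1 p.2).1
  have hc0 : ∀ p, c p = 0 := fun p => (hbc p.1 p.2).2
  -- (8) a = 0 by C2′, level by level on the cumulated function
  have hzsum_a : ∀ w u, u ∈ P ∩ F w → (∑ p, a p * (if p.1 ⊆ w ∧ p.2 ⊆ u then (1 : ℚ) else 0)) = 0 := by
    intro w u hu
    have h1 := hB w u hu
    have hzb : (∑ p, b p * (if p.1 ⊆ w ∧ p.2 ⊆ u then (1 : ℚ) else 0)) = 0 := by
      exact Finset.sum_eq_zero fun p _ => by rw [hb0 p, zero_mul]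
    linarith
  have hcum : ∀ w d, (∑ v, (if v ⊆ w then (1 : ℚ) else 0) * a (v, d)) = 0 := by
    intro w
    refine eq_zero_of_zeta_sum_eq_zero_inter P (F w) hP (hF w)
      (fun d => ∑ v, (if v ⊆ w then (1 : ℚ) else 0) * a (v, d)) ?_ ?_
    · intro d hd
      obtain ⟨v, -, hv⟩ := Finset.exists_ne_zero_of_sum_ne_zero hd
      have hvw : v ⊆ w := by
        by_contra hn; apply hv; rw [if_neg hn, zero_mul]
      have hav : a (v, d) ≠ 0 := fun h0 => hv (by rw [h0, mul_zero])
      have hmem := ha (v, d) hav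
      rw [mem_inter] at hmem ⊢
      exact ⟨hmem.1, hFm hvw hmem.2⟩
    · intro u hu
      have hz := hzsum_a w u hu
      rw [zsum_eq_sum_lsum] at hz
      have hre : ∑ d, (∑ v, (if v ⊆ w then (1 : ℚ) else 0) * a (v, d)) * (if d ⊆ u then (1 : ℚ) else 0)
          = ∑ v, (if v ⊆ w then (1 : ℚ) else 0) * (∑ d, a (v, d) * (if d ⊆ u then (1 : ℚ) else 0)) := by
        simp only [Finset.sum_mul, Finset.mul_sum, mul_assoc]
        rw [Finset.sum_comm]
      rw [hre]
      exact hz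
  have ha0 : ∀ v d, a (v, d) = 0 := by
    intro v
    induction v using Finset.strongInduction with
    | H v ih =>
      intro d
      have h := hcum v d
      rw [← Finset.add_sum_erase _ _ (mem_univ v), if_pos (Finset.Subset.refl v), one_mul] at h
      have hrest : ∑ v' ∈ univ.erase v, (if v' ⊆ v then (1 : ℚ) else 0) * a (v', d) = 0 := by
        refine Finset.sum_eq_zero fun v' hv' => ?_
        have hne : v' ≠ v := (mem_erase.1 hv').1
        by_cases hsub : v' ⊆ v
        · rw [ih v' (Finset.ssubset_iff_subset_ne.2 ⟨hsub, hne⟩) d, mul_zero]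
        · rw [if_neg hsub, zero_mul]
      rw [hrest, add_zero] at h
      exact h
  exact ⟨fun p => ha0 p.1 p.2, hb0, hc0⟩

/-! ### From the kernel statement to `tiltCert 1` and to `0 ≤ triW` -/

omit [Fintype β] [Fintype γ] in
/-- The plain certificate entries: `tiltCert 1 (i,p) (j,q) = [p ≤ q]·M i j` with the 339 pattern `M = !![1,1,0; 0,1,0; 1,0,1]`. [this work] -/
theorem tiltCert_one_eq (i j : Fin 3) (p q : Finset β × Finset γ) :
    tiltCert 1 (i, p) (j, q) = (if p.1 ⊆ q.1 ∧ p.2 ⊆ q.2 then (1 : ℚ) else 0) * (!![1, 1, 0; 0, 1, 0; 1, 0, 1] : Matrix (Fin 3) (Fin 3) ℚ) i j := by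
  unfold tiltCert
  by_cases h : p.1 ⊆ q.1 ∧ p.2 ⊆ q.2
  · simp only [h, and_self, if_true, one_mul, one_pow]
    fin_cases i <;> fin_cases j <;> simp
  · simp only [h, if_false, zero_mul]

/-- **The plain two-copy certificate has independent rows when `P` is self-dual** (`uᶜ ∈ P ↔ u ∉ P`), for every monotone family of up-sets `F`
and every index cube. [this work] -/
theorem linearIndependent_tiltCert_one_of_selfDual (P : Finset (Finset γ)) (F : Finset β → Finset (Finset γ))
    (hP : IsUpperSet (P : Set (Finset γ))) (hF : ∀ x, IsUpperSet (F x : Set (Finset γ))) (hFm : Monotone F)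
    (hsd : ∀ u : Finset γ, uᶜ ∈ P ↔ u ∉ P) :
    LinearIndependent ℚ (fun r : ↥(dipoleDem P F) => fun c : ↥(dipoleSup P F) => tiltCert 1 r.1 c.1) := by
  classical
  rw [Fintype.linearIndependent_iff]
  intro g hg
  -- extend `g` by zero to all tokens
  let G : Token β γ → ℚ := fun t => if h : t ∈ dipoleDem P F then g ⟨t, h⟩ else 0
  have hGr : ∀ r : ↥(dipoleDem P F), G r.1 = g r := fun r => by simp [G, r.2]
  have hGsupp : ∀ i p, G (i, p) ≠ 0 → p.2 ∈ demSet P F i p.1 := by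
    intro i p hne
    by_cases hmem : (i, p) ∈ dipoleDem P F
    · simpa [dipoleDem] using hmem
    · exact absurd (by simp [G, hmem]) hne
  -- the column equations of `Σ_r g r • row r = 0`
  have hcol : ∀ s : Token β γ, s ∈ dipoleSup P F →
      ∑ i : Fin 3, ∑ p : Finset β × Finset γ, G (i, p) * tiltCert 1 (i, p) s = 0 := by
    intro s hs
    have h0 := congrFun hg ⟨s, hs⟩
    rw [Finset.sum_apply] at h0
    simp only [Pi.smul_apply, smul_eq_mul, Pi.zero_apply] at h0
    rw [← Fintype.sum_prod_type (f := fun t : Token β γ => G t * tiltCert 1 t s)]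
    rw [← Finset.sum_subset (subset_univ (dipoleDem P F)) (fun t _ ht => by simp [G, ht]),
      ← Finset.sum_coe_sort (dipoleDem P F) (fun t => G t * tiltCert 1 t s)]
    simpa only [hGr] using h0
  -- the three coefficient functions
  set a : Finset β × Finset γ → ℚ := fun p => G (0, p) with ha_def
  set b : Finset β × Finset γ → ℚ := fun p => G (1, p) with hb_def
  set c : Finset β × Finset γ → ℚ := fun p => G (2, p) with hc_def
  have ha : ∀ p, a p ≠ 0 → p.2 ∈ refl P ∩ F p.1 := fun p hp => by simpa [demSet] using hGsupp 0 p hp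
  have hb : ∀ p, b p ≠ 0 → p.2 ∈ P ∩ refl (F p.1ᶜ) := fun p hp => by simpa [demSet] using hGsupp 1 p hp
  have hc : ∀ p, c p ≠ 0 → p.2 ∈ refl P ∩ refl (F p.1ᶜ) := fun p hp => by simpa [demSet] using hGsupp 2 p hp
  have hsupA : ∀ w u, u ∈ P ∩ F w → ((0 : Fin 3), (w, u)) ∈ dipoleSup P F := fun w u hu => by simpa [dipoleSup, supSet] using hu
  have hsupB : ∀ w u, u ∈ P ∩ F w → ((1 : Fin 3), (w, u)) ∈ dipoleSup P F := fun w u hu => by simpa [dipoleSup, supSet] using hu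
  have hsupE : ∀ w u, u ∈ refl P ∩ F wᶜ → ((2 : Fin 3), (w, u)) ∈ dipoleSup P F := fun w u hu => by simpa [dipoleSup, supSet] using hu
  have hA : ∀ w u, u ∈ P ∩ F w → (∑ p, a p * (if p.1 ⊆ w ∧ p.2 ⊆ u then (1 : ℚ) else 0))
      + (∑ p, c p * (if p.1 ⊆ w ∧ p.2 ⊆ u then (1 : ℚ) else 0)) = 0 := by
    intro w u hu
    have h := hcol _ (hsupA w u hu)
    rw [Fin.sum_univ_three] at h
    simpa [tiltCert_one_eq, ha_def, hc_def] using h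
  have hB : ∀ w u, u ∈ P ∩ F w → (∑ p, a p * (if p.1 ⊆ w ∧ p.2 ⊆ u then (1 : ℚ) else 0))
      + (∑ p, b p * (if p.1 ⊆ w ∧ p.2 ⊆ u then (1 : ℚ) else 0)) = 0 := by
    intro w u hu
    have h := hcol _ (hsupB w u hu)
    rw [Fin.sum_univ_three] at h
    simpa [tiltCert_one_eq, ha_def, hb_def] using h
  have hE : ∀ w u, u ∈ refl P ∩ F wᶜ → (∑ p, c p * (if p.1 ⊆ w ∧ p.2 ⊆ u then (1 : ℚ) else 0)) = 0 := by
    intro w u hu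
    have h := hcol _ (hsupE w u hu)
    rw [Fin.sum_univ_three] at h
    simpa [tiltCert_one_eq, hc_def] using h
  obtain ⟨ha0, hb0, hc0⟩ := plainKernel_selfDual P F hP hF hFm hsd a b c ha hb hc hA hB hE
  intro r
  rw [← hGr r]
  obtain ⟨⟨i, p⟩, hr⟩ := r
  fin_cases i
  · exact ha0 p
  · exact hb0 p
  · exact hc0 p

/-- **`TRI_W(a) ≥ 0` on the SELF-DUAL stratum.**  For every index cube `Finset β`, every cube `Finset γ`, every SELF-DUAL up-set `P`
(`uᶜ ∈ P ↔ u ∉ P`: the maximal intersecting families — dictators, odd majorities, …) and all monotone families of up-sets `F, G`: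
`0 ≤ triW P F G`.  Unconditional; the first stratum of `TriWIneq` for `a ≥ 2` defined by a condition on `P` alone that is disjoint from
`refl P ⊆ P` (`triW_nonneg_of_refl_subset`).  For cells: the (M⁺⁺-3) triangle coefficient is non-negative whenever the member not depending on
the shared block is self-dual. [this work] -/
theorem triW_nonneg_of_selfDual (P : Finset (Finset γ)) (F G : Finset β → Finset (Finset γ))
    (hP : IsUpperSet (P : Set (Finset γ))) (hF : ∀ x, IsUpperSet (F x : Set (Finset γ)))
    (hG : ∀ x, IsUpperSet (G x : Set (Finset γ))) (hFm : Monotone F) (hGm : Monotone G)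
    (hsd : ∀ u : Finset γ, uᶜ ∈ P ↔ u ∉ P) : 0 ≤ triW P F G :=
  triW_nonneg_of_dipoleRankCert P F G hG hGm (tiltCert 1) (fun r c h => tiltCert_ne_zero 1 r c h)
    (linearIndependent_tiltCert_one_of_selfDual P F hP hF hFm hsd)

end FiveUpSet

end Summit.CriticalPhenomena.PercolationContinuityZ3.Theorems
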